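import Mathlib.Analysis.SpecialFunctions.Integrals.Basic
import Mathlib.Analysis.SpecialFunctions.Trigonometric.Bounds
import HarnessLib

/-!
# K1loc, line `Spectral` — S-D (first good piece): THE OSCILLATORY INTEGRAL OVER A GOOD CHORD

Helper file of the prover lane on the crux `K1LocalisedCascade` (stmt-AnomalousDissipation-19491), route
`SawtoothPulseCascade`, registered line `Cruxes.K1LocalisedCascade.Spectral` (one open stub `stub_highModeConcentration`).
Channel (L) of the analytic first good piece (memo v8 §1): on a good horizontal chord `[a, b]` of a cell the phase of the inviscid
iterate is affine up to `ε`, `|φ(s) − (k s + c)| ≤ ε` (`…K1Start.abs_phase_sub_affine_le`, `|k| ≥ (γ²−3)^n`), so the chord's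
contribution to the `m`-th horizontal Fourier coefficient of the datum `sin 2πφ` is a boundary term plus the defect:

* `norm_integral_exp_two_pi_I_mul_le` — `‖∫_a^b e^{2πi(λs + c)} ds‖ ≤ 1/(π|λ|)` (`λ ≠ 0`);
* `norm_integral_sin_affine_mul_exp_le` — `‖∫_a^b sin(2π(ks + c)) e^{−2πims} ds‖ ≤ (1/(π|k − m|) + 1/(π|k + m|))/2` (`k ≠ ±m`);
* `norm_integral_sin_phase_mul_exp_le` — for continuous `φ` with `|φ(s) − (ks + c)| ≤ ε` on `[a, b]`:
  `‖∫_a^b sin(2πφ(s)) e^{−2πims} ds‖ ≤ (1/(π|k − m|) + 1/(π|k + m|))/2 + 2πε(b − a)`.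

Pure one-variable calculus (Mathlib's `integral_exp_mul_complex`, Lipschitz bound of `sin`).  WHAT THIS IS NOT: no count of the chords
per line (memo v8 §1 (L), the open design). [cite: Grafakos2014, Prop. 3.1.2 (coefficients of characters and their translates)] [problem: turb]
-/

-- `Summit.<Summit>.<Problem>`: single-conjunct summit, the duplicate namespace segment is deliberate.
set_option linter.dupNamespace false

noncomputable section

namespace Summit.AnomalousDissipation.AnomalousDissipation.Theorems.SawtoothPulseCascade.K1Start

open Set MeasureTheory intervalIntegral Complex

/-- **A character integrates to a boundary term**: `‖∫_a^b e^{2πi(λs + c)} ds‖ ≤ 1/(π|λ|)` for real `λ ≠ 0`, `c`, any `a, b`.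
[cite: Grafakos2014, Prop. 3.1.2] -/
theorem norm_integral_exp_two_pi_I_mul_le {l : ℝ} (hl : l ≠ 0) (c a b : ℝ) :
    ‖∫ s in a..b, exp (2 * Real.pi * I * (l * s + c))‖ ≤ 1 / (Real.pi * |l|) := by
  have hπ : 0 < Real.pi := Real.pi_pos
  set κ : ℂ := 2 * Real.pi * I * l with hκ
  have hκ0 : κ ≠ 0 := by
    rw [hκ]; exact mul_ne_zero (mul_ne_zero (mul_ne_zero two_ne_zero (ofReal_ne_zero.mpr hπ.ne')) I_ne_zero)
      (ofReal_ne_zero.mpr hl)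
  have hnormκ : ‖κ‖ = 2 * Real.pi * |l| := by
    rw [hκ, norm_mul, norm_mul, norm_mul, norm_I, mul_one, Complex.norm_real, Complex.norm_two, Complex.norm_real,
      Real.norm_eq_abs, Real.norm_eq_abs, abs_of_pos hπ]
  -- factor the constant phase and integrate the character
  have hfun : (fun s : ℝ => exp (2 * Real.pi * I * (l * s + c))) = fun s : ℝ => exp (2 * Real.pi * I * c) * exp (κ * s) := by
    funext s; rw [← Complex.exp_add, hκ]; ring_nf
  rw [hfun, intervalIntegral.integral_const_mul, integral_exp_mul_complex hκ0, norm_mul, Complex.norm_exp]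
  have hre : (2 * Real.pi * I * c).re = 0 := by simp
  rw [hre, Real.exp_zero, one_mul, norm_div, hnormκ]
  have hnum : ‖exp (κ * b) - exp (κ * a)‖ ≤ 2 := by
    have h1 : ‖exp (κ * b)‖ = 1 := by rw [Complex.norm_exp, hκ]; simp
    have h2 : ‖exp (κ * a)‖ = 1 := by rw [Complex.norm_exp, hκ]; simp
    calc ‖exp (κ * b) - exp (κ * a)‖ ≤ ‖exp (κ * b)‖ + ‖exp (κ * a)‖ := norm_sub_le _ _
      _ = 2 := by rw [h1, h2]; norm_num
  have hl0 : 0 < |l| := abs_pos.mpr hl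
  calc ‖exp (κ * b) - exp (κ * a)‖ / (2 * Real.pi * |l|) ≤ 2 / (2 * Real.pi * |l|) :=
        div_le_div_of_nonneg_right hnum (by positivity)
    _ = 1 / (Real.pi * |l|) := by field_simp

/-- **An affine-phase sine against a character**: for `k ≠ m`, `k ≠ −m`:
`‖∫_a^b sin(2π(ks + c)) e^{−2πims} ds‖ ≤ (1/(π|k − m|) + 1/(π|k + m|))/2`. [cite: Grafakos2014, Prop. 3.1.2] -/
theorem norm_integral_sin_affine_mul_exp_le {k m : ℝ} (hkm : k ≠ m) (hkm' : k ≠ -m) (c a b : ℝ) :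
    ‖∫ s in a..b, (Real.sin (2 * Real.pi * (k * s + c)) : ℂ) * exp (-(2 * Real.pi * I * (m * s)))‖ ≤
      (1 / (Real.pi * |k - m|) + 1 / (Real.pi * |k + m|)) / 2 := by
  -- `sin θ · e^{−2πims} = (e^{2πi((k−m)s + c)} − e^{2πi((−k−m)s − c)}) / (2i)`
  have hfun : (fun s : ℝ => (Real.sin (2 * Real.pi * (k * s + c)) : ℂ) * exp (-(2 * Real.pi * I * (m * s)))) =
      fun s : ℝ => (exp (2 * Real.pi * I * ((k - m) * s + c)) - exp (2 * Real.pi * I * ((-k - m) * s + -c))) * (-I / 2) := by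
    funext s
    rw [Complex.ofReal_sin, Complex.sin]
    have e1 : -((2 * Real.pi * (k * s + c) : ℝ) : ℂ) * I + -(2 * Real.pi * I * (m * s)) =
        2 * Real.pi * I * ((-k - m) * s + -c) := by push_cast; ring
    have e2 : ((2 * Real.pi * (k * s + c) : ℝ) : ℂ) * I + -(2 * Real.pi * I * (m * s)) =
        2 * Real.pi * I * ((k - m) * s + c) := by push_cast; ring
    rw [show (exp (-((2 * Real.pi * (k * s + c) : ℝ) : ℂ) * I) - exp (((2 * Real.pi * (k * s + c) : ℝ) : ℂ) * I)) * I / 2 *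
        exp (-(2 * Real.pi * I * (m * s))) =
        (exp (-((2 * Real.pi * (k * s + c) : ℝ) : ℂ) * I) * exp (-(2 * Real.pi * I * (m * s))) -
          exp (((2 * Real.pi * (k * s + c) : ℝ) : ℂ) * I) * exp (-(2 * Real.pi * I * (m * s)))) * (I / 2) by ring,
      ← Complex.exp_add, ← Complex.exp_add, e1, e2]
    ring
  have hi1 : IntervalIntegrable (fun s : ℝ => exp (2 * Real.pi * I * ((k - m) * s + c))) volume a b :=
    (Continuous.intervalIntegrable (by fun_prop) _ _)
  have hi2 : IntervalIntegrable (fun s : ℝ => exp (2 * Real.pi * I * ((-k - m) * s + -c))) volume a b :=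
    (Continuous.intervalIntegrable (by fun_prop) _ _)
  rw [hfun, intervalIntegral.integral_mul_const, intervalIntegral.integral_sub hi1 hi2, norm_mul]
  have hI : ‖(-I / 2 : ℂ)‖ = 1 / 2 := by simp
  rw [hI]
  have h1 := norm_integral_exp_two_pi_I_mul_le (sub_ne_zero.mpr hkm) c a b
  have h2 := norm_integral_exp_two_pi_I_mul_le (show -k - m ≠ 0 by intro h; apply hkm'; linarith) (-c) a b
  rw [show |-k - m| = |k + m| by rw [← abs_neg]; ring_nf] at h2
  push_cast at h1 h2
  calc ‖(∫ s in a..b, exp (2 * Real.pi * I * ((k - m) * s + c))) - ∫ s in a..b, exp (2 * Real.pi * I * ((-k - m) * s + -c))‖ * (1 / 2)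
      ≤ (‖∫ s in a..b, exp (2 * Real.pi * I * ((k - m) * s + c))‖ + ‖∫ s in a..b, exp (2 * Real.pi * I * ((-k - m) * s + -c))‖) * (1 / 2) :=
        mul_le_mul_of_nonneg_right (norm_sub_le _ _) (by norm_num)
    _ ≤ (1 / (Real.pi * |k - m|) + 1 / (Real.pi * |k + m|)) * (1 / 2) := by gcongr
    _ = (1 / (Real.pi * |k - m|) + 1 / (Real.pi * |k + m|)) / 2 := by ring

/-- **The oscillatory integral over a good chord.**  If `φ` is continuous and `|φ(s) − (ks + c)| ≤ ε` for `s ∈ [a, b]` (`a ≤ b`),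
`k ≠ ±m`, then `‖∫_a^b sin(2πφ(s)) e^{−2πims} ds‖ ≤ (1/(π|k − m|) + 1/(π|k + m|))/2 + 2πε(b − a)`
(the affine model integrates to boundary terms; `sin` is `1`-Lipschitz). [cite: Grafakos2014, Prop. 3.1.2] -/
theorem norm_integral_sin_phase_mul_exp_le {φ : ℝ → ℝ} (hφ : Continuous φ) {k m c ε a b : ℝ} (hab : a ≤ b) (hkm : k ≠ m)
    (hkm' : k ≠ -m) (hε : ∀ s ∈ Icc a b, |φ s - (k * s + c)| ≤ ε) :
    ‖∫ s in a..b, (Real.sin (2 * Real.pi * φ s) : ℂ) * exp (-(2 * Real.pi * I * (m * s)))‖ ≤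
      (1 / (Real.pi * |k - m|) + 1 / (Real.pi * |k + m|)) / 2 + 2 * Real.pi * ε * (b - a) := by
  set F : ℝ → ℂ := fun s => (Real.sin (2 * Real.pi * φ s) : ℂ) * exp (-(2 * Real.pi * I * (m * s))) with hF
  set G : ℝ → ℂ := fun s => (Real.sin (2 * Real.pi * (k * s + c)) : ℂ) * exp (-(2 * Real.pi * I * (m * s))) with hG
  have hFc : Continuous F := by
    refine Continuous.mul (Complex.continuous_ofReal.comp (Real.continuous_sin.comp (continuous_const.mul hφ))) ?_
    fun_prop
  have hGc : Continuous G := by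
    refine Continuous.mul (Complex.continuous_ofReal.comp (Real.continuous_sin.comp ?_)) ?_ <;> fun_prop
  have hFi : IntervalIntegrable F volume a b := hFc.intervalIntegrable _ _
  have hGi : IntervalIntegrable G volume a b := hGc.intervalIntegrable _ _
  -- pointwise defect `‖F − G‖ ≤ 2πε`
  have hdef : ∀ s ∈ Set.uIoc a b, ‖F s - G s‖ ≤ 2 * Real.pi * ε := by
    intro s hs
    rw [uIoc_of_le hab] at hs
    have hs' : s ∈ Icc a b := ⟨hs.1.le, hs.2⟩
    have hexp : ‖exp (-(2 * Real.pi * I * (m * s)))‖ = 1 := by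
      rw [Complex.norm_exp]; simp
    rw [hF, hG]
    simp only
    rw [← sub_mul, norm_mul, hexp, mul_one, ← Complex.ofReal_sub, Complex.norm_real, Real.norm_eq_abs]
    calc |Real.sin (2 * Real.pi * φ s) - Real.sin (2 * Real.pi * (k * s + c))|
        ≤ |2 * Real.pi * φ s - 2 * Real.pi * (k * s + c)| := Real.abs_sin_sub_sin_le _ _
      _ = 2 * Real.pi * |φ s - (k * s + c)| := by
          rw [← mul_sub, abs_mul, abs_of_pos Real.two_pi_pos]
      _ ≤ 2 * Real.pi * ε := mul_le_mul_of_nonneg_left (hε s hs') Real.two_pi_pos.le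
  have hsplit : ∫ s in a..b, F s = (∫ s in a..b, G s) + ∫ s in a..b, (F s - G s) := by
    rw [intervalIntegral.integral_sub hFi hGi]; ring
  rw [hsplit]
  refine (norm_add_le _ _).trans (add_le_add (norm_integral_sin_affine_mul_exp_le hkm hkm' c a b) ?_)
  have h := intervalIntegral.norm_integral_le_of_norm_le_const (f := fun s => F s - G s) hdef
  rw [abs_of_nonneg (sub_nonneg.mpr hab)] at h
  linarith

end Summit.AnomalousDissipation.AnomalousDissipation.Theorems.SawtoothPulseCascade.K1Start
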